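import Mathlib
import HarnessLib
import Summits.PneNP.PneNP.Theses.CnfIdealGenLength
import Literature.Computability.Complexity.ArthurMerlinKarpClosure
import Summits.PneNP.PneNP.Theorems.CnfIdealGenLengthRankDefectRepresentationsDiagonal
import Summits.PneNP.PneNP.Theorems.CnfIdealGenLengthRankDefectRepresentationsTseitinTransfer

/-!
# Crux `RankDefectRepresentations` (stmt-PneNP-18923), line `rank-dehn-ladder`: the crux IS tautology instability

With the transfer stub `stub_tseitinTransfer` kernel-checked (`…TseitinTransfer`), the crux admits an equivalent form with no
CNF / clause-product bookkeeping:

* `rankDefectRepresentations_iff_tautologyInstability` —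
  `RankDefectRepresentations ↔ ∃ s ∈ ℕ[X], ∀ c, ∀ᶠ n, ∃ K (char 0), d, t, M : Fin n → K^{d×d}, T : PropForm (Fin n)` with
  `M` a `t`-almost-representation, `T` a TAUTOLOGY of size `≤ s(n)` and `rank tr(T)(M) > n^c · t`.

(⇒) an unsatisfiable CNF `φ` is read as the tautology `T_φ = ¬ ⋀_κ ⋁_{l ∈ κ} l` (an explicit `foldr`, no new definition) with
`tr(T_φ) = clauseProduct φ` EXACTLY (`tr_negCnfForm`) and `size T_φ ≤ 3·size φ + 2·numClauses φ + 2`.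
(⇐) `stub_tseitinTransfer` turns the tautology on `n = ⌊N^{1/e}⌋` letters into an unsatisfiable CNF on `N` variables with
`≤ (N+2)^a` clauses and an almost-representation on `N` letters whose clause-product rank dominates; the exponent bookkeeping
is that of the line's composition `RankDefectRepresentations_of`, and the diagonal lemma (`exists_diag_phantom`) makes one CNF
family out of the per-exponent witnesses.
CONSEQUENCE for the ladder: the two load-bearing stubs `stub_certifiedInstability` + `stub_cnfUniversality` can be replaced by
the single crux-EQUIVALENT rung "tautology instability"; the arithmetic-formula universality stub is no longer needed.
HONEST FRAMING: an equivalent reformulation of the crux (both directions kernel-checked); the crux, GL_noncomm and P ≠ NP are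
NOT moved; F-N2 is a FRONTIER formal rung.
-/

set_option linter.dupNamespace false -- `Summit.PneNP.PneNP.…`: summit = sub-problem name (D-0017)

namespace Summit.PneNP.PneNP.Theorems.CnfIdealGenLengthRankDefectRepresentationsIffTautologyInstability

open Filter
open Literature.Computability.Complexity
open Literature.Computability.MetaComplexity
open Literature.Computability.MetaComplexity.NCIPS
open Summit.PneNP.PneNP.Theorems.CnfIdealGenLengthRankDefectRepresentationsDiagonal (exists_diag_phantom)
open Summit.PneNP.PneNP.Theorems.CnfIdealGenLengthRankDefectRepresentationsTseitinTransfer (stub_tseitinTransfer)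

/-! ## The tautology of an unsatisfiable CNF -/

section CnfForm

variable {R : Type} [CommRing R] {ν : Type}

/-- `tr` of the disjunction `⋁_{l ∈ κ} l` (right fold, base `false`) is the clause word `Q_κ`.
[cite: LiTzameretWang2018, Def. 1.3 with Def. 1.6] -/
theorem tr_clauseForm (κ : Clause ν) :
    tr R (κ.foldr (fun l acc => PropForm.disj (if l.2 then PropForm.var l.1 else PropForm.neg (PropForm.var l.1)) acc)
      (PropForm.const false)) = clauseWord R κ := by
  induction κ with
  | nil => simp
  | cons l κ ih => rw [List.foldr_cons, tr_disj, ih, tr_literal, clauseWord_cons]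

/-- `tr` of `¬ ⋀_κ ⋁_{l∈κ} l` (right folds, bases `true`/`false`) is the clause product `P_φ` exactly.
[cite: LiTzameretWang2018, Def. 1.3 with Def. 1.6] -/
theorem tr_negCnfForm (φ : CNF ν) :
    tr R (PropForm.neg (φ.foldr (fun κ acc => PropForm.conj
      (κ.foldr (fun l acc => PropForm.disj (if l.2 then PropForm.var l.1 else PropForm.neg (PropForm.var l.1)) acc)
        (PropForm.const false)) acc) (PropForm.const true))) = clauseProduct R φ := by
  rw [tr_neg]
  induction φ with
  | nil => simp
  | cons κ φ ih =>
      rw [List.foldr_cons, tr_conj, sub_sub_cancel, tr_clauseForm, clauseProduct_cons, ← ih]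

/-- Size of the clause formula: `≤ 3·|κ| + 1`. [folklore] -/
theorem size_clauseForm_le (κ : Clause ν) :
    (κ.foldr (fun l acc => PropForm.disj (if l.2 then PropForm.var l.1 else PropForm.neg (PropForm.var l.1)) acc)
      (PropForm.const false)).size ≤ 3 * κ.length + 1 := by
  induction κ with
  | nil => simp [PropForm.size]
  | cons l κ ih =>
      rw [List.foldr_cons]
      rcases l with ⟨i, b⟩
      cases b <;> simp only [PropForm.size, List.length_cons, Bool.false_eq_true, if_false, if_true] <;> omega

/-- Size of the CNF tautology: `≤ 3·size φ + 2·numClauses φ + 2`. [folklore] -/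
theorem size_negCnfForm_le (φ : CNF ν) :
    (PropForm.neg (φ.foldr (fun κ acc => PropForm.conj
      (κ.foldr (fun l acc => PropForm.disj (if l.2 then PropForm.var l.1 else PropForm.neg (PropForm.var l.1)) acc)
        (PropForm.const false)) acc) (PropForm.const true))).size ≤ 3 * φ.size + 2 * φ.numClauses + 2 := by
  simp only [PropForm.size, CNF.size, CNF.numClauses]
  suffices h : ∀ ψ : CNF ν, (ψ.foldr (fun κ acc => PropForm.conj
      (κ.foldr (fun l acc => PropForm.disj (if l.2 then PropForm.var l.1 else PropForm.neg (PropForm.var l.1)) acc)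
        (PropForm.const false)) acc) (PropForm.const true)).size ≤ 3 * (ψ.map List.length).sum + 2 * ψ.length + 1 by
    have := h φ; omega
  intro ψ
  induction ψ with
  | nil => simp [PropForm.size]
  | cons κ ψ ih =>
      rw [List.foldr_cons]
      have hκ := size_clauseForm_le (ν := ν) κ
      simp only [PropForm.size, List.map_cons, List.sum_cons, List.length_cons]
      omega

/-- For an UNSATISFIABLE CNF the formula `¬ ⋀_κ ⋁ l` is a tautology (via faithfulness of `tr`). [folklore] -/
theorem isTautology_negCnfForm {K : Type} [Field K] (φ : CNF ν) (hφ : ¬ φ.Satisfiable) :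
    (PropForm.neg (φ.foldr (fun κ acc => PropForm.conj
      (κ.foldr (fun l acc => PropForm.disj (if l.2 then PropForm.var l.1 else PropForm.neg (PropForm.var l.1)) acc)
        (PropForm.const false)) acc) (PropForm.const true))).IsTautology := by
  rw [isTautology_iff_boolEval_tr (R := K)]
  intro σ
  rw [tr_negCnfForm, boolEval_clauseProduct]
  have : φ.eval σ ≠ true := fun h => hφ ⟨σ, h⟩
  simp [this]

end CnfForm

/-! ## Pointwise form of the crux (diagonalisation) -/

/-- From per-exponent CNF witnesses under a uniform size polynomial to one CNF family (the `⇐` half of the line's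
`rankDefectRepresentations_iff_pointwise`, via the landed diagonal lemma). [folklore] -/
theorem rdr_of_pointwise (p : Polynomial ℕ)
    (hp : ∀ c : ℕ, ∀ᶠ n : ℕ in atTop, ∃ φ : CNF (Fin n),
      (¬ φ.Satisfiable ∧ φ.numClauses ≤ p.eval n ∧ φ.size ≤ p.eval n) ∧
        ∃ (K : Type) (_ : Field K) (_ : CharZero K) (d t : ℕ) (M : Fin n → Matrix (Fin d) (Fin d) K),
          (∀ g : MonoidAlgebra K (FreeMonoid (Fin n)), IsAxiom g →
            (MonoidAlgebra.lift K (Matrix (Fin d) (Fin d) K) (FreeMonoid (Fin n)) (FreeMonoid.lift M) g).rank ≤ t) ∧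
          n ^ c * t < (MonoidAlgebra.lift K (Matrix (Fin d) (Fin d) K) (FreeMonoid (Fin n)) (FreeMonoid.lift M)
            (clauseProduct K φ)).rank) :
    Summit.PneNP.PneNP.Theses.CnfIdealGenLength.RankDefectRepresentations := by
  classical
  obtain ⟨g, hg, hP⟩ := exists_diag_phantom hp
  let Q : ℕ → Prop := fun n => ∃ φ : CNF (Fin n),
    (¬ φ.Satisfiable ∧ φ.numClauses ≤ p.eval n ∧ φ.size ≤ p.eval n) ∧
      ∃ (K : Type) (_ : Field K) (_ : CharZero K) (d t : ℕ) (M : Fin n → Matrix (Fin d) (Fin d) K),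
        (∀ g : MonoidAlgebra K (FreeMonoid (Fin n)), IsAxiom g →
          (MonoidAlgebra.lift K (Matrix (Fin d) (Fin d) K) (FreeMonoid (Fin n)) (FreeMonoid.lift M) g).rank ≤ t) ∧
        n ^ g n * t < (MonoidAlgebra.lift K (Matrix (Fin d) (Fin d) K) (FreeMonoid (Fin n)) (FreeMonoid.lift M)
          (clauseProduct K φ)).rank
  have hQ : ∀ᶠ n in atTop, Q n := hP.mono fun n hn => hn (g n) le_rfl
  let fam : (n : ℕ) → CNF (Fin n) := fun n => if hq : Q n then Classical.choose hq else [[]]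
  refine ⟨p + 1, fam, fun n => ?_, fun c => ?_⟩
  · by_cases hq : Q n
    · obtain ⟨⟨h1, h2, h3⟩, -⟩ := Classical.choose_spec hq
      simp only [fam, dif_pos hq, Polynomial.eval_add, Polynomial.eval_one]
      exact ⟨h1, by omega, by omega⟩
    · simp only [fam, dif_neg hq, Polynomial.eval_add, Polynomial.eval_one]
      refine ⟨CNF.not_satisfiable_of_nil_mem (List.mem_singleton_self _), ?_, ?_⟩
      · simp [CNF.numClauses]
      · simp [CNF.size]
  · filter_upwards [hg c, hQ, eventually_ge_atTop 1] with n hcg hq hn1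
    obtain ⟨-, K, iF, iC, d, t, M, hM, hlt⟩ := Classical.choose_spec hq
    simp only [fam, dif_pos hq]
    refine ⟨K, iF, iC, d, t, M, hM, lt_of_le_of_lt ?_ hlt⟩
    exact Nat.mul_le_mul_right t (Nat.pow_le_pow_right hn1 hcg)

/-- Integer `e`-th roots: `r N = ⌊N^{1/e}⌋` with `(r N)^e ≤ N < (r N + 1)^e` and `r N → ∞`. [folklore] -/
theorem exists_root_fun' (e : ℕ) (he : 1 ≤ e) :
    ∃ r : ℕ → ℕ, (∀ N, r N ^ e ≤ N) ∧ (∀ N, N < (r N + 1) ^ e) ∧ ∀ m, ∀ᶠ N in atTop, m ≤ r N := by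
  refine ⟨fun N => Nat.findGreatest (fun m => m ^ e ≤ N) N, fun N => ?_, fun N => ?_, fun m => ?_⟩
  · have h0 : (0 : ℕ) ^ e ≤ N := by rw [zero_pow (by omega)]; exact Nat.zero_le _
    exact Nat.findGreatest_spec (P := fun m => m ^ e ≤ N) (Nat.zero_le N) h0
  · by_contra hcon
    rw [not_lt] at hcon
    have hle : Nat.findGreatest (fun m => m ^ e ≤ N) N + 1 ≤ N :=
      le_trans (Nat.le_self_pow (by omega) _) hcon
    exact Nat.findGreatest_is_greatest (lt_add_one _) hle hcon
  · filter_upwards [eventually_ge_atTop (m ^ e)] with N hN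
    exact Nat.le_findGreatest ((Nat.le_self_pow (by omega) m).trans hN) hN

/-! ## The equivalence -/

/-- **The crux is tautology instability.** `RankDefectRepresentations` holds iff there are, under a uniform size polynomial,
for every exponent `c` and all large `n`, a `t`-almost-representation `M` on `n` letters over a field of characteristic `0` and
a propositional TAUTOLOGY `T` of polynomial size whose LTW translation has `rank tr(T)(M) > n^c · t`.  (⇐ uses the
kernel-checked transfer `stub_tseitinTransfer`; ⇒ reads an unsatisfiable CNF as the tautology `¬⋀⋁`.) [folklore] -/
theorem rankDefectRepresentations_iff_tautologyInstability :
    Summit.PneNP.PneNP.Theses.CnfIdealGenLength.RankDefectRepresentations ↔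
      ∃ s : Polynomial ℕ, ∀ c : ℕ, ∀ᶠ n : ℕ in atTop, ∃ (K : Type) (_ : Field K) (_ : CharZero K) (d t : ℕ)
        (M : Fin n → Matrix (Fin d) (Fin d) K) (T : PropForm (Fin n)),
        (∀ g : MonoidAlgebra K (FreeMonoid (Fin n)), IsAxiom g →
          (MonoidAlgebra.lift K (Matrix (Fin d) (Fin d) K) (FreeMonoid (Fin n)) (FreeMonoid.lift M) g).rank ≤ t) ∧
        T.IsTautology ∧ T.size ≤ s.eval n ∧
        n ^ c * t < (MonoidAlgebra.lift K (Matrix (Fin d) (Fin d) K) (FreeMonoid (Fin n)) (FreeMonoid.lift M) (tr K T)).rank := by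
  constructor
  · -- (⇒): read the CNF as a tautology
    rintro ⟨p, φ, hφ, h⟩
    refine ⟨5 * p + 2, fun c => (h c).mono fun n hn => ?_⟩
    obtain ⟨K, iF, iC, d, t, M, hM, hlt⟩ := hn
    refine ⟨K, iF, iC, d, t, M, _, hM, isTautology_negCnfForm (K := K) (φ n) (hφ n).1, ?_, ?_⟩
    · refine (size_negCnfForm_le (φ n)).trans ?_
      have h1 := (hφ n).2.1; have h2 := (hφ n).2.2
      simp only [Polynomial.eval_add, Polynomial.eval_mul, Polynomial.eval_ofNat]
      omega
    · rwa [tr_negCnfForm]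
  · -- (⇐): Tseitin transfer on `n = ⌊N^{1/e}⌋` letters, then diagonalise
    rintro ⟨s, hs⟩
    obtain ⟨a, ha⟩ := stub_tseitinTransfer
    obtain ⟨e, he1, he⟩ := exists_pow_bound (Polynomial.X + s + 2)
    obtain ⟨r, hr1, hr2, hr3⟩ := exists_root_fun' e he1
    apply rdr_of_pointwise (Polynomial.X ^ (2 * a))
    intro c
    set k := c + 4 * a + 2 with hk
    have hev : ∀ᶠ N : ℕ in atTop, ∃ (K : Type) (_ : Field K) (_ : CharZero K) (d t : ℕ)
        (M : Fin (r N) → Matrix (Fin d) (Fin d) K) (T : PropForm (Fin (r N))),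
        (∀ g : MonoidAlgebra K (FreeMonoid (Fin (r N))), IsAxiom g →
          (MonoidAlgebra.lift K (Matrix (Fin d) (Fin d) K) (FreeMonoid (Fin (r N))) (FreeMonoid.lift M) g).rank ≤ t) ∧
        T.IsTautology ∧ T.size ≤ s.eval (r N) ∧
        (r N) ^ (e * k) * t <
          (MonoidAlgebra.lift K (Matrix (Fin d) (Fin d) K) (FreeMonoid (Fin (r N))) (FreeMonoid.lift M) (tr K T)).rank := by
      obtain ⟨N₀, hN₀⟩ := eventually_atTop.mp (hs (e * k))
      filter_upwards [hr3 N₀] with N hN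
      exact hN₀ (r N) hN
    filter_upwards [hev, hr3 2, eventually_ge_atTop (2 ^ (e * k)), eventually_ge_atTop 2] with N hN hrN hN2k hN2
    obtain ⟨K, iF, iC, d, t, M, T, hM, hT, hsize, hlt⟩ := hN
    have hroom : r N + T.size ≤ N := by
      have h1 : r N + s.eval (r N) + 2 ≤ r N ^ e := by
        have := he (r N) hrN
        simpa [Polynomial.eval_add, Polynomial.eval_X] using this
      have h2 : r N ^ e ≤ N := hr1 N
      omega
    obtain ⟨φ, hunsat, hnum, hsz, d', t', M', hM', ht', hR⟩ := ha (r N) N K d t M T hT hM hroom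
    have hpeval : (Polynomial.X ^ (2 * a) : Polynomial ℕ).eval N = N ^ (2 * a) := by
      simp [Polynomial.eval_pow, Polynomial.eval_X]
    have hB : (N + 2) ^ a ≤ N ^ (2 * a) := by
      rw [pow_mul]
      exact Nat.pow_le_pow_left (by nlinarith) a
    refine ⟨φ, ⟨hunsat, ?_, ?_⟩, K, iF, iC, d', t', M', hM', ?_⟩
    · rw [hpeval]; exact hnum.trans hB
    · rw [hpeval]; exact hsz.trans hB
    by_contra hcon
    rw [not_lt] at hcon
    have hB1 : 1 ≤ (N + 2) ^ a := Nat.one_le_pow _ _ (by omega)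
    have hc1 : 1 ≤ N ^ c := Nat.one_le_pow _ _ (by omega)
    have h1cB : 1 ≤ N ^ c * (N + 2) ^ a := by
      calc (1 : ℕ) = 1 * 1 := rfl
        _ ≤ N ^ c * (N + 2) ^ a := Nat.mul_le_mul hc1 hB1
    have htle : t ≤ N ^ c * ((N + 2) ^ a * t) := by
      calc t = 1 * t := (one_mul t).symm
        _ ≤ (N ^ c * (N + 2) ^ a) * t := Nat.mul_le_mul_right t h1cB
        _ = N ^ c * ((N + 2) ^ a * t) := by ring
    -- upper bound for the certified rank
    have key : (MonoidAlgebra.lift K (Matrix (Fin d) (Fin d) K) (FreeMonoid (Fin (r N))) (FreeMonoid.lift M)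
        (tr K T)).rank ≤ N ^ (4 * a + c + 1) * t :=
      calc (MonoidAlgebra.lift K (Matrix (Fin d) (Fin d) K) (FreeMonoid (Fin (r N))) (FreeMonoid.lift M) (tr K T)).rank
          ≤ (N + 2) ^ a * ((MonoidAlgebra.lift K (Matrix (Fin d') (Fin d') K) (FreeMonoid (Fin N)) (FreeMonoid.lift M')
              (clauseProduct K φ)).rank + t) := hR
        _ ≤ (N + 2) ^ a * (N ^ c * t' + t) := Nat.mul_le_mul_left _ (Nat.add_le_add_right hcon t)
        _ ≤ (N + 2) ^ a * (N ^ c * ((N + 2) ^ a * t) + t) :=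
            Nat.mul_le_mul_left _ (Nat.add_le_add_right (Nat.mul_le_mul_left _ ht') t)
        _ ≤ (N + 2) ^ a * (N ^ c * ((N + 2) ^ a * t) + N ^ c * ((N + 2) ^ a * t)) :=
            Nat.mul_le_mul_left _ (Nat.add_le_add_left htle _)
        _ = 2 * ((N + 2) ^ a * (N + 2) ^ a) * N ^ c * t := by ring
        _ ≤ 2 * (N ^ (2 * a) * N ^ (2 * a)) * N ^ c * t := by gcongr
        _ = 2 * N ^ (4 * a + c) * t := by ring
        _ ≤ N * N ^ (4 * a + c) * t := Nat.mul_le_mul_right t (Nat.mul_le_mul_right _ hN2)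
        _ = N ^ (4 * a + c + 1) * t := by ring
    -- lower bound: (r N)^{e k} ≥ N^{4a+c+1}
    have hNk : N ^ k < ((2 * r N) ^ e) ^ k := by
      have h' : N < (2 * r N) ^ e := lt_of_lt_of_le (hr2 N) (Nat.pow_le_pow_left (by omega) e)
      exact Nat.pow_lt_pow_left h' (by omega)
    have hsplit : ((2 * r N) ^ e) ^ k = 2 ^ (e * k) * (r N) ^ (e * k) := by
      rw [← pow_mul, mul_pow]
    have hNk' : 2 ^ (e * k) * N ^ (4 * a + c + 1) ≤ N ^ k :=
      calc 2 ^ (e * k) * N ^ (4 * a + c + 1) = N ^ (4 * a + c + 1) * 2 ^ (e * k) := mul_comm _ _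
        _ ≤ N ^ (4 * a + c + 1) * N := Nat.mul_le_mul_left _ hN2k
        _ = N ^ k := by rw [hk]; ring
    have hnN : N ^ (4 * a + c + 1) < (r N) ^ (e * k) :=
      Nat.lt_of_mul_lt_mul_left (lt_of_le_of_lt hNk' (hsplit ▸ hNk))
    have : (MonoidAlgebra.lift K (Matrix (Fin d) (Fin d) K) (FreeMonoid (Fin (r N))) (FreeMonoid.lift M) (tr K T)).rank
        ≤ (r N) ^ (e * k) * t := key.trans (Nat.mul_le_mul_right t hnN.le)
    exact absurd hlt (not_lt.mpr this)

end Summit.PneNP.PneNP.Theorems.CnfIdealGenLengthRankDefectRepresentationsIffTautologyInstability
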